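import Summits.BirchSwinnertonDyer.BirchSwinnertonDyer.Theorems.ByReductionTypeAtTwoMultTransportTwistedDescentDualControl
import Summits.BirchSwinnertonDyer.BirchSwinnertonDyer.Theorems.ByReductionTypeAtTwoMultTransportTwistedDescentStrictLift
import HarnessLib

/-!
# T-42 in the kernel, LXXVIII — road (S-C′), brick B2 (ii): DUAL-SIDE CONTROL for the structure `𝓕₀ = 𝓕.strictAt S₀` —
# a dual Selmer class of `H¹_{𝓕₀^*}(K, E[p^J](χ_u)^D)`, read in `E[p^J](χ_{u'})`, maps into the NON-PRIMITIVE Selmer group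
# `Sel^{Σ₀}_{p^∞}(E/K_∞)` (twin of XXIII with the strictness at `S₀` dropped)

Cell `bsd-2adic` (run/shared/lean/pub/bsd-2adic/), seat `bsd-2adic-t42` GEN 32 (pen RC-521 «(S-C′) FUNDED», memo
`t42/DESIGN-T42-ADDENDUM-35.md` §A35.8 (i)). HONEST FRAMING: research route; THEOREMS ONLY (no `def`, no named fact, no instance,
no `sorry`); nothing booked; no door or class file is touched; BSD is not proved by any of this. PARTITION: X5@2 multiplicative
GV-transport rows (K4ᵐ B1·O1; the PRINT binder F1) × p = 2 — reduces-the-named-input-of; bears_on K4 items 19922 / 19923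
(`--supports stmt-BirchSwinnertonDyer-19923`).

## What

XXIII (`twistedTorsionToH1_mem_selmerInfty_of_mem_dualSelmer`) sends the Weil reading `y'` of a dual class
`y = H¹(w) y' ∈ H¹_{𝓕^*}(K, E[p^J](χ_u)^D)` into `Sel_{p^∞}(E/K_∞)`, using at the omitted primes `v ∈ S₀` the STRICT dual condition
(`𝓕_v = ⊤ ⇒ 𝓕^*_v = 0`). For the structure `𝓕₀ = 𝓕.strictAt S₀` of LXXVI (exact targets at `S₀`) the dual condition at `S₀` is
EVERYTHING (`(0)^* = H¹(K_v, M^D)`, LXXVI `dualSelmerStructure_strictKummer_inr_of_mem`), so nothing is known there — and nothing is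
needed for the NON-PRIMITIVE group `Sel^{Σ₀}` (GV p. 7: no condition above `Σ₀`). Off `S₀` the dual conditions of `𝓕₀` and `𝓕` agree
(LXXVI `dualSelmerStructure_strictKummer_inl` / `_inr_of_not_mem`), and XXIII's place-wise arguments go through verbatim:

* `res_mem_unramifiedSubgroup_of_mem_dualSelmer_strict` — at a finite `v ∉ S₀`, `v ∤ p` with `E[p^J](χ_u)` unramified and `p^J ∉ v`,
  `res_v y'` is unramified (Milne I 2.6 via `UnramifiedOrthogonal`, transport through `w`, injectivity of `H¹(w)` over `K_v^{ur}`);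
* `twistedTorsionToH1_mem_localKerOver_of_mem_dualSelmer_strict` — hence `twistedTorsionToH1 y'` is Kummer at such `v` over the
  cyclotomic tower (XX + `Additive.unramKer_le_localKerOver_of_isCyclotomic`);
* **`twistedTorsionToH1_mem_nonPrimitiveSelmerInfty_of_mem_dualSelmer_strict`** — with the two local dual Kummer statements at the
  places above `p` (`hδp`) and at `∞` (`hδinf`) as hypotheses (discharged in the engine from `δ2`/`δinf` exactly as in XXIV-b′),
  `twistedTorsionToH1 y' ∈ Sel^{Σ₀}_{p^∞}(E/K_∞)` (`GreenbergVatsal2000.nonPrimitiveSelmerInfty`), all conjugates included.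

So the engine's exponent input `ha` («`p^a` kills the `u`-eigenvectors of `conj_γ`») is to be supplied on `Sel^{Σ₀}_∞` — finite for
generic `u` when `X^{Σ₀}` is `Λ`-torsion (LXX `cor23_moduleHalf_two` + LXXIV at `n = 0`), the successor's discharge.

References: [GreenbergLNM1716] §4 pp. 122–126; [GreenbergVatsal2000] §1 p. 7, §2 pp. 16–17; [MilneADT2006] I Thm. 2.6.
-/

set_option autoImplicit false
set_option linter.dupNamespace false

noncomputable section

open scoped Classical ContRepresentation

namespace Summit.BirchSwinnertonDyer.BirchSwinnertonDyer.Theorems.MultTransportTwistedDescent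

open NumberField IsDedekindDomain Field WeierstrassCurve CategoryTheory
  Literature.NumberTheory.EllipticCurves Literature.NumberTheory.EllipticCurves.GreenbergVatsal2000
  Literature.NumberTheory.GaloisRepresentations Literature.NumberTheory.GaloisCohomology
open Literature.NumberTheory.GaloisRepresentations.DiscreteGaloisModule (localTatePairingZMod
  unramifiedSubgroup SelmerStructure TateDual)

variable {K : Type} [Field K] [NumberField K] (W : WeierstrassCurve K) [W.IsElliptic] (p : ℕ) [Fact p.Prime]
  (κ : ZpExtension K p) (S₀ : Finset (HeightOneSpectrum (𝓞 K))) (J : ℕ) {u u' : ℤ}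
  (hu : (p : ℤ) ∣ u - 1) (hu' : (p : ℤ) ∣ u' - 1) (huu' : ((p : ℤ) ^ J) ∣ u * u' - 1)
  (e : W.geomTorsion ((p ^ J : ℕ) : ℤ) → W.geomTorsion ((p ^ J : ℕ) : ℤ) → AlgebraicClosure K)
  (hμ : ∀ S T, e S T ^ (p ^ J) = 1)
  (hadd₁ : ∀ S₁ S₂ T, e (S₁ + S₂) T = e S₁ T * e S₂ T)
  (hadd₂ : ∀ S T₁ T₂, e S (T₁ + T₂) = e S T₁ * e S T₂)
  (hgal : ∀ (σ : absoluteGaloisGroup K) (S T : W.geomTorsion ((p ^ J : ℕ) : ℤ)),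
    σ • e S T = e (σ • S) (σ • T))
  (hnondeg : ∀ T, (∀ S, e S T = 1) → T = 0)
  [Finite (W.geomTorsion ((p ^ J : ℕ) : ℤ))]

section Weil

variable [CharZero K]

include hnondeg

/-- **At a good place `v ∉ S₀`, `v ∤ p`, the Weil reading `y'` of a dual class of `H¹_{𝓕₀^*}` is unramified** (XXIII's
`res_mem_unramifiedSubgroup_of_mem_dualSelmer` verbatim: the dual condition of `𝓕₀` at `v ∉ S₀` is that of `𝓕`, i.e. of
`H¹_ur(M_J)`, which is `H¹_ur(M_J^D)` by Milne I 2.6; unramifiedness commutes with `H¹(w)`, injective over `K_v^{ur}`).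
[cite: MilneADT2006, Ch. I, Thm. 2.6] [cite: GreenbergLNM1716, §4 p. 124] -/
theorem res_mem_unramifiedSubgroup_of_mem_dualSelmer_strict {inv : LocalInvariants K (p ^ J)}
    (hUO : inv.UnramifiedOrthogonal)
    (y' : galoisCohomology (W.twistedTorsionGaloisModule p κ J u' hu') 1)
    (hy : galoisCohomology.map (W.twistedWeilDual p κ J hu hu' huu' e hμ hadd₁ hadd₂ hgal) 1 y' ∈
      (inv.dualSelmerStructure (W.twistedTorsionGaloisModule p κ J u hu)
        ((W.twistedKummerSelmerStructure p S₀ κ J u hu).strictAt S₀)).selmerGroup)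
    {v : HeightOneSpectrum (𝓞 K)} (hv : v ∉ S₀) (hpv : ((p : ℕ) : 𝓞 K) ∉ v.asIdeal)
    (hpJ : ((p ^ J : ℕ) : 𝓞 K) ∉ v.asIdeal)
    (hur : GaloisRep.IsUnramifiedAt v (W.twistedTorsionGaloisModule p κ J u hu)) :
    galoisCohomology.res (W.twistedTorsionGaloisModule p κ J u' hu') (v.adicCompletion K) 1 y' ∈
      unramifiedSubgroup ((W.twistedTorsionGaloisModule p κ J u' hu').restrictField (v.adicCompletion K)) 1 := by
  set wJ := W.twistedWeilDual p κ J hu hu' huu' e hμ hadd₁ hadd₂ hgal with hwJ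
  set wI := W.twistedWeilDualInv p κ J hu hu' huu' e hμ hadd₁ hadd₂ hgal hnondeg with hwI
  rw [SelmerStructure.mem_selmerGroup_iff] at hy
  have hyv := hy (Sum.inr v)
  rw [dualSelmerStructure_strictKummer_inr_of_not_mem W p S₀ κ J u hu inv hv, LocalInvariants.dualSelmerStructure_apply,
    W.twistedKummerSelmerStructure_inr_of_not_mem p S₀ κ J u hu hv hpv,
    (hUO (W.twistedTorsionGaloisModule p κ J u hu) (W.pow_nsmul_geomTorsion_pow p J) v hpJ hur).1] at hyv
  -- `hyv : loc_v (H¹(w) y') ∈ H¹_ur(M_J^D)`, i.e. its restriction to `K_v^{ur}` vanishes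
  replace hyv := (DiscreteGaloisModule.mem_unramifiedSubgroup_iff _ _ _).mp hyv
  refine (DiscreteGaloisModule.mem_unramifiedSubgroup_iff _ _ _).mpr ?_
  have h1 : galoisCohomology.localization ((W.twistedTorsionGaloisModule p κ J u hu).tateDual (p ^ J))
      (Sum.inr v) 1 (galoisCohomology.map wJ 1 y') =
      galoisCohomology.map (wJ.restrictField (v.adicCompletion K)) 1
        (galoisCohomology.res (W.twistedTorsionGaloisModule p κ J u' hu') (v.adicCompletion K) 1 y') :=
    W.res_map_twistedWeilDual p κ J hu hu' huu' e hμ hadd₁ hadd₂ hgal (v.adicCompletion K) y'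
  have h2 := galoisCohomology.res_map_one
    (IsNonarchimedeanLocalField.maxUnramified (v.adicCompletion K)) (wJ.restrictField (v.adicCompletion K))
    (galoisCohomology.res (W.twistedTorsionGaloisModule p κ J u' hu') (v.adicCompletion K) 1 y')
  have h3 : galoisCohomology.map
      ((wJ.restrictField (v.adicCompletion K)).restrictField
        (IsNonarchimedeanLocalField.maxUnramified (v.adicCompletion K))) 1
      (galoisCohomology.res ((W.twistedTorsionGaloisModule p κ J u' hu').restrictField (v.adicCompletion K))
        (IsNonarchimedeanLocalField.maxUnramified (v.adicCompletion K)) 1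
        (galoisCohomology.res (W.twistedTorsionGaloisModule p κ J u' hu') (v.adicCompletion K) 1 y')) = 0 := by
    rw [← h2]
    have h1' := congrArg (galoisCohomology.res
      (((W.twistedTorsionGaloisModule p κ J u hu).tateDual (p ^ J)).restrictField (v.adicCompletion K))
      (IsNonarchimedeanLocalField.maxUnramified (v.adicCompletion K)) 1) h1
    rw [← h1']
    exact hyv
  refine map_injective_of_leftInverse
    ((wJ.restrictField (v.adicCompletion K)).restrictField
      (IsNonarchimedeanLocalField.maxUnramified (v.adicCompletion K)))
    ((wI.restrictField (v.adicCompletion K)).restrictField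
      (IsNonarchimedeanLocalField.maxUnramified (v.adicCompletion K)))
    (fun m ↦ W.twistedWeilDualInv_apply p κ J hu hu' huu' e hμ hadd₁ hadd₂ hgal hnondeg m) ?_
  rw [h3, map_zero]

/-- **At a good place `v ∉ S₀`, `v ∤ p` (cyclotomic tower): `twistedTorsionToH1 y'` is Kummer at `v` over `K_∞`** for `y'` the Weil
reading of a dual class of `H¹_{𝓕₀^*}` — unramified (file XX) hence Kummer (`Additive.unramKer_le_localKerOver_of_isCyclotomic`, any
reduction at `v ∤ p`). [cite: GreenbergVatsal2000, §2 p. 17] [cite: GreenbergLNM1716, §2 pp. 69–72] -/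
theorem twistedTorsionToH1_mem_localKerOver_of_mem_dualSelmer_strict (hκ : κ.IsCyclotomic)
    {inv : LocalInvariants K (p ^ J)} (hUO : inv.UnramifiedOrthogonal)
    (y' : galoisCohomology (W.twistedTorsionGaloisModule p κ J u' hu') 1)
    (hy : galoisCohomology.map (W.twistedWeilDual p κ J hu hu' huu' e hμ hadd₁ hadd₂ hgal) 1 y' ∈
      (inv.dualSelmerStructure (W.twistedTorsionGaloisModule p κ J u hu)
        ((W.twistedKummerSelmerStructure p S₀ κ J u hu).strictAt S₀)).selmerGroup)
    {v : HeightOneSpectrum (𝓞 K)} (hv : v ∉ S₀) (hpv : ((p : ℕ) : 𝓞 K) ∉ v.asIdeal)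
    (hpJ : ((p ^ J : ℕ) : 𝓞 K) ∉ v.asIdeal)
    (hur : GaloisRep.IsUnramifiedAt v (W.twistedTorsionGaloisModule p κ J u hu)) :
    W.twistedTorsionToH1 p κ J u' hu' y' ∈ W.localKerOver p κ.kerSubgroup (v.adicCompletion K) := by
  have hmem : W.twistedTorsionToH1 p κ J u' hu' y' ∈
      GreenbergVatsal2000.unramifiedKer κ.kerSubgroup (W.geomPrimaryTorsion p) v :=
    twistedTorsionToH1_mem_unramifiedKer W p κ J u' hu' v y'
      (res_mem_unramifiedSubgroup_of_mem_dualSelmer_strict W p κ S₀ J hu hu' huu' e hμ hadd₁ hadd₂ hgal hnondeg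
        hUO y' hy hv hpv hpJ hur)
  exact Summit.BirchSwinnertonDyer.Rank1Residual.Additive.unramKer_le_localKerOver_of_isCyclotomic
    (κ := κ) (W := W) (p := p) (v := v) hκ hpv hmem

/-- **Dual-side control for `𝓕₀ = 𝓕.strictAt S₀` into the NON-PRIMITIVE Selmer group.** Let `inv` have `UnramifiedOrthogonal`, `κ` be
CYCLOTOMIC, and `E[p^J](χ_u)` be unramified with `p^J ∉ v` outside `S = ∞ ∪ S₀ ∪ {v ∣ p}`. Let `y = H¹(w) y' ∈ H¹_{𝓕₀^*}(K, E[p^J](χ_u)^D)`.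
If the local classes of `y'` die in `H¹((K_∞)_w, E)` at the places above `p` outside `S₀` (`hδp`) and at the infinite places (`hδinf`),
then `twistedTorsionToH1 y' ∈ Sel^{Σ₀}_{p^∞}(E/K_∞)`: NO condition above `S₀`, Kummer at the good places (unramified ⇒ Kummer), at
`p` and `∞` (hypotheses), and at all conjugate places (`conjH1_twistedTorsionToH1_mem`). Greenberg p. 124 with GV's non-primitive
group: the dual Selmer classes live in `S^{Σ₀}_{M^*}(F_∞) = Sel^{Σ₀} ⊗ κ^{-s}`. [cite: GreenbergLNM1716, §4 pp. 123–124]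
[cite: GreenbergVatsal2000, §1 p. 7, §2 pp. 16–17] -/
theorem twistedTorsionToH1_mem_nonPrimitiveSelmerInfty_of_mem_dualSelmer_strict (hκ : κ.IsCyclotomic)
    (hS : ∀ v : HeightOneSpectrum (𝓞 K), (Sum.inr v : Place K) ∉ twistedDescentPlaces (K := K) p S₀ →
      ((p ^ J : ℕ) : 𝓞 K) ∉ v.asIdeal ∧ GaloisRep.IsUnramifiedAt v (W.twistedTorsionGaloisModule p κ J u hu))
    {inv : LocalInvariants K (p ^ J)} (hUO : inv.UnramifiedOrthogonal)
    (y' : galoisCohomology (W.twistedTorsionGaloisModule p κ J u' hu') 1)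
    (hy : galoisCohomology.map (W.twistedWeilDual p κ J hu hu' huu' e hμ hadd₁ hadd₂ hgal) 1 y' ∈
      (inv.dualSelmerStructure (W.twistedTorsionGaloisModule p κ J u hu)
        ((W.twistedKummerSelmerStructure p S₀ κ J u hu).strictAt S₀)).selmerGroup)
    (hδp : ∀ v : HeightOneSpectrum (𝓞 K), ((p : ℕ) : 𝓞 K) ∈ v.asIdeal →
      W.twistedTorsionToLocalH1 p κ J u' hu' (v.adicCompletion K)
        (galoisCohomology.res (W.twistedTorsionGaloisModule p κ J u' hu') (v.adicCompletion K) 1 y') = 0)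
    (hδinf : ∀ w : InfinitePlace K,
      W.twistedTorsionToLocalH1 p κ J u' hu' w.Completion
        (galoisCohomology.res (W.twistedTorsionGaloisModule p κ J u' hu') w.Completion 1 y') = 0) :
    W.twistedTorsionToH1 p κ J u' hu' y' ∈ nonPrimitiveSelmerInfty W κ (↑S₀ : Set (HeightOneSpectrum (𝓞 K))) := by
  set c := W.twistedTorsionToH1 p κ J u' hu' y' with hc
  -- Kummer at every finite `v ∉ S₀` (chosen place), then all conjugates
  have hfin : ∀ v : HeightOneSpectrum (𝓞 K), v ∉ S₀ → c ∈ W.localKerOver p κ.kerSubgroup (v.adicCompletion K) := by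
    intro v hvS
    by_cases hpv : ((p : ℕ) : 𝓞 K) ∈ v.asIdeal
    · rw [WeierstrassCurve.mem_localKerOver_iff, hc, W.localResOver_twistedTorsionToH1 p κ J u' hu']
      exact hδp v hpv
    · have hvS' : (Sum.inr v : Place K) ∉ twistedDescentPlaces (K := K) p S₀ :=
        (not_mem_twistedDescentPlaces_iff p S₀ v).2 ⟨hvS, hpv⟩
      exact twistedTorsionToH1_mem_localKerOver_of_mem_dualSelmer_strict W p κ S₀ J hu hu' huu' e hμ hadd₁ hadd₂
        hgal hnondeg hκ hUO y' hy hvS hpv (hS v hvS').1 (hS v hvS').2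
  have hinf : ∀ w : InfinitePlace K, c ∈ W.localKerOver p κ.kerSubgroup w.Completion := fun w ↦ by
    rw [WeierstrassCurve.mem_localKerOver_iff, hc, W.localResOver_twistedTorsionToH1 p κ J u' hu']
    exact hδinf w
  rw [nonPrimitiveSelmerInfty_eq, mem_nonPrimitiveSelmerGroupOver_iff]
  exact ⟨fun v hv σ ↦ W.conjH1_twistedTorsionToH1_mem p κ J u' hu' _ y' (hfin v (fun h ↦ hv (Finset.mem_coe.2 h))) σ,
    fun w σ ↦ W.conjH1_twistedTorsionToH1_mem p κ J u' hu' _ y' (hinf w) σ⟩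

end Weil

end Summit.BirchSwinnertonDyer.BirchSwinnertonDyer.Theorems.MultTransportTwistedDescent

end
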